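import Literature.Analysis.PDE.TorusMoserCommutator
import Literature.Analysis.PDE.TorusWordEnergyMargin
import Literature.Analysis.FunctionSpaces.TorusWordSupEmbedding
import HarnessLib

/-!
# Crude Moser-type commutator estimates on `𝕋^ι` at a generic Sobolev margin `σ`
# (topic `Analysis/PDE`)

Analysis/PDE support file (everything proved; no definitions, no named facts): the
dimension-generic form of `Literature.Analysis.PDE.TorusMoserCommutator`. There the three
estimates that consume the Sobolev sup embedding carry the hypothesis `Fintype.card ι = 3` and
the margin `2` of `H²(𝕋³) ⊂ L^∞`; here the embedding enters as the HYPOTHESIS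
`hS : Torus.WordSupEmbedding ι σ` (`‖f x‖² ≤ C_s · twordEnergy σ f`, discharged for every
`#ι < 2σ` by `Torus.wordSupEmbedding_of_lt`) and every threshold is shifted accordingly
(`2 ↦ σ`: sup bounds `|v| + σ ≤ m`, base level `m ≥ 2σ + 2`, regularity step `m ≥ 2σ + 4`,
constants from `exists_sup_bound_cwd_comp (m - σ)` resp. `(m - (σ+1))`). The proofs are those
of the `𝕋³` file verbatim with these substitutions [Majda1984, Ch. 2 §2.1, proof of Thm 2.1,
Prop. 2.1 (2.1)–(2.2) in the crude form in which every factor but the one of highest order is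
taken in the sup norm; valid in any space dimension once `m - σ ≥ m/2 + 1`]:

* `exists_sup_iterPartialDeriv_comp_le_of_wordSup` — `‖∂^v (G ∘ V)(x)‖ ≤ C(G, m, E₀)` for
  `|v| + σ ≤ m` under `twordEnergy m V ≤ E₀`;
* `exists_tcomm_sq_integral_le_of_wordSup` (**base level**, `m ≥ 2σ + 2`):
  `∫ ‖[∂^w, G(V)] ∂ⱼU‖² ≤ C(G, m, E₀) · twordEnergy m U` for `|w| ≤ m`;
* `exists_tcomm_sq_integral_le_step_of_wordSup` (**regularity step**, `m ≥ 2σ + 4`):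
  `∫ ‖[∂^w, G(V)] ∂ⱼU‖² ≤ C · (twordEnergy m U + twordEnergy m V + 1)` under level-`(m-1)`
  bounds on both fields;
* `wordSupEmbedding_two_of_card_eq_three` — on `#ι = 3` the tree's real-variable
  `exists_norm_sq_le_twordEnergy_two` is `WordSupEmbedding ι 2`, so the `𝕋³` theorems are the
  `σ = 2` instances (`6 = 2·2+2`, `8 = 2·2+4`).

The commutator `tcomm`, its lifted Leibniz expansion `lift_tcomm_eq` and the two elementary term
bounds `l2On_clm_apply_le_of_norm_le(_right)` are `ι`-generic in `TorusMoserCommutator` and are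
used from there, not re-proved. With `σ = 3` on `𝕋⁴` (`Torus.wordSupEmbedding_fin4_three`) these
are the commutator estimates of a four-dimensional symmetric-hyperbolic energy chain.

## Mathlib / tree search

Tree: `tcomm`, `lift_tcomm_eq`, `isSmooth_tcomm`, `l2On_clm_apply_le_of_norm_le(_right)`,
`length_le_two_pow_of_splittings_eq_cons` (`TorusMoserCommutator`); `exists_sup_bound_cwd_comp`,
`exists_tame_bound_cwd_comp`, `l2On_list_sum_le` (`CoordWordTame`);
`norm_cwd_lift_le_sqrt_of_margin` (`TorusWordEnergyMargin`); `Torus.WordSupEmbedding`,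
`Torus.wordSupEmbedding_of_lt` (`FunctionSpaces/TorusWordSupEmbedding`). Searched
`lean search 'tcomm|of_wordSup|WordSupEmbedding|Moser'`: no generic-margin commutator estimate
in the tree; Mathlib has no torus Sobolev calculus.

## References

* A. Majda, *Compressible Fluid Flow and Systems of Conservation Laws in Several Space
  Variables*, Springer 1984, Ch. 2 §2.1, Thm 2.1 and Prop. 2.1–2.2. [`Majda1984`]
* M. E. Taylor, *Partial Differential Equations III*, 2nd ed., Springer 2011, Ch. 13 §3,
  Props. 3.6–3.9 (Moser estimates). [`TaylorPDEIII2011`]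
* R. A. Adams, *Sobolev Spaces*, Academic Press 1975, Thm. 5.4 Part I Case C. [`Adams1975`]
-/

noncomputable section

open MeasureTheory Set Filter Function
open scoped ContDiff InnerProductSpace Topology ENNReal

namespace Literature.Analysis.PDE

open Literature.Analysis.FunctionSpaces Literature.Analysis.FunctionSpaces.Torus

universe u v

variable {ι : Type v} [Fintype ι] [DecidableEq ι]
variable {W W' : Type u} [NormedAddCommGroup W] [NormedSpace ℝ W] [NormedAddCommGroup W']
  [NormedSpace ℝ W']

/-! ## Sup bounds for composites, `σ` orders below the energy level -/

section Sup

variable [FiniteDimensional ℝ W]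

/-- **Sup bounds for the word derivatives of a composite** `x ↦ G (V x)`, `σ` orders below the
energy level: under a word-form sup embedding at margin `σ` and `twordEnergy m V ≤ E₀`,
`‖∂^v (G ∘ V)(x)‖ ≤ C(G, m, E₀)` for `|v| + σ ≤ m` (the tree's `exists_sup_bound_cwd_comp`).
The `𝕋³` case `σ = 2` is `exists_sup_iterPartialDeriv_comp_le`.
[cite: Majda1984, Ch. 2 §2.1, Prop. 2.2] -/
theorem exists_sup_iterPartialDeriv_comp_le_of_wordSup {σ : ℕ} (hS : WordSupEmbedding.{u, v} ι σ)
    {X : Type u} [NormedAddCommGroup X] [NormedSpace ℝ X] {G : W → X} (hG : ContDiff ℝ ∞ G)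
    (m : ℕ) (E₀ : ℝ) :
    ∃ C : ℝ, 0 ≤ C ∧ ∀ V : UnitAddTorus ι → W, IsSmooth V → twordEnergy m V ≤ E₀ →
      ∀ v : List ι, v.length + σ ≤ m → ∀ x, ‖iterPartialDeriv v (fun y => G (V y)) x‖ ≤ C := by
  obtain ⟨Cs, hCs0, hCs⟩ := hS W
  have hK : IsCompact (closedCube ι) := isCompact_closedCube
  set F : EuclideanSpace ℝ ι × W → X := fun z => G z.2 with hF_def
  have hF : ContDiff ℝ ∞ F := hG.comp contDiff_snd
  obtain ⟨C₁, hC₁0, hC₁⟩ :=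
    exists_sup_bound_cwd_comp (ι := ι) (J := W) (m - σ) hF hK (√(Cs * E₀))
  refine ⟨C₁, hC₁0, fun V hV hVE v hv x => ?_⟩
  have hVsup : ∀ c : List ι, c.length ≤ m - σ → ∀ y ∈ closedCube ι,
      ‖cwd c (lift V) y‖ ≤ √(Cs * E₀) :=
    fun c hc y _ => (norm_cwd_lift_le_sqrt_of_margin hCs hCs0.le hV (by omega) y).trans
      (Real.sqrt_le_sqrt (mul_le_mul_of_nonneg_left hVE hCs0.le))
  have hC : IsSmooth fun y => G (V y) := isSmooth_comp hG hV
  refine norm_le_of_forall_mem_closedCube (fun y hy => ?_) x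
  rw [lift_iterPartialDeriv_eq_cwd hC]
  exact hC₁ (lift V) hV hVsup v (by omega) y hy

end Sup

/-! ## The commutator estimates at a generic margin -/

section Commutator

variable [FiniteDimensional ℝ W]

/-- **Base-level commutator estimate at margin `σ`** (`m ≥ 2σ + 2`): under a word-form sup
embedding at margin `σ` on `𝕋^ι`, for a smooth operator-valued `G` and an energy bound `E₀` there
is `C ≥ 0` such that for all smooth `V, U` with `twordEnergy m V ≤ E₀`, all words `|w| ≤ m` and
all `j`,

  `∫_𝕋 ‖[∂^w, G(V)] ∂ⱼU‖² ≤ C · twordEnergy m U`.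

The `𝕋³` case `σ = 2`, `m ≥ 6` is `exists_tcomm_sq_integral_le`.
[cite: Majda1984, Ch. 2 §2.1, proof of Thm 2.1, Prop. 2.1 (2.2)] -/
theorem exists_tcomm_sq_integral_le_of_wordSup {σ : ℕ} (hS : WordSupEmbedding.{u, v} ι σ)
    {G : W → (W →L[ℝ] W')} (hG : ContDiff ℝ ∞ G) {m : ℕ} (hm : 2 * σ + 2 ≤ m) (E₀ : ℝ) :
    ∃ C : ℝ, 0 ≤ C ∧ ∀ V U : UnitAddTorus ι → W, IsSmooth V → IsSmooth U →
      twordEnergy m V ≤ E₀ → ∀ w ∈ wordsLE ι m, ∀ j : ι,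
        ∫ x, ‖tcomm G V w (partialDeriv j U) x‖ ^ 2 ≤ C * twordEnergy m U := by
  obtain ⟨Cs, hCs0, hCs⟩ := hS W
  have hK : IsCompact (closedCube ι) := isCompact_closedCube
  set R₁ : ℝ := √(Cs * E₀) with hR₁_def
  set F : EuclideanSpace ℝ ι × W → (W →L[ℝ] W') := fun z => G z.2 with hF_def
  have hF : ContDiff ℝ ∞ F := hG.comp contDiff_snd
  obtain ⟨C₁, hC₁0, hC₁⟩ := exists_sup_bound_cwd_comp (ι := ι) (J := W) (m - σ) hF hK R₁
  obtain ⟨C₂, hC₂0, hC₂⟩ := exists_tame_bound_cwd_comp (ι := ι) (J := W) m hF hK R₁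
  set T : ℝ := max C₁ (√Cs * (C₂ * (1 + √E₀))) with hT_def
  have hT0 : 0 ≤ T := hC₁0.trans (le_max_left _ _)
  refine ⟨(2 ^ m * T) ^ 2, by positivity, fun V U hV hU hVE w hw j => ?_⟩
  have hwm : w.length ≤ m := mem_wordsLE.1 hw
  -- control of the coefficient field `V`
  have hVsup : ∀ c : List ι, c.length ≤ m - σ → ∀ y ∈ closedCube ι, ‖cwd c (lift V) y‖ ≤ R₁ :=
    fun c hc y _ => (norm_cwd_lift_le_sqrt_of_margin hCs hCs0.le hV (by omega) y).trans
      (Real.sqrt_le_sqrt (mul_le_mul_of_nonneg_left hVE hCs0.le))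
  have hVsup' : ∀ c : List ι, c.length ≤ m / 2 + 1 → ∀ y ∈ closedCube ι, ‖cwd c (lift V) y‖ ≤ R₁ :=
    fun c hc => hVsup c (by omega)
  have hVl2 : ∀ c : List ι, c.length ≤ m → l2On (closedCube ι) (cwd c (lift V)) ≤ √E₀ :=
    fun c hc => (l2On_cwd_lift_le_sqrt_twordEnergy hV hc).trans (Real.sqrt_le_sqrt hVE)
  have hGV : ContDiff ℝ ∞ fun y => G (lift V y) := hG.comp hV
  have h1 : ∀ v : List ι, v.length ≤ m - σ → ∀ y ∈ closedCube ι,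
      ‖cwd v (fun z => G (lift V z)) y‖ ≤ C₁ := hC₁ (lift V) hV hVsup
  have h2 : ∀ v : List ι, v.length ≤ m →
      l2On (closedCube ι) (cwd v (fun z => G (lift V z))) ≤ C₂ * (1 + √E₀) :=
    hC₂ (lift V) hV hVsup' (√E₀) (Real.sqrt_nonneg _) hVl2
  -- control of `U`
  set EU : ℝ := twordEnergy m U with hEU_def
  have hEU0 : 0 ≤ EU := twordEnergy_nonneg m U
  have hUj : IsSmooth (partialDeriv j U) := hU.partialDeriv j
  have hcwdU : ∀ c : List ι, cwd c (lift (partialDeriv j U)) = cwd (c ++ [j]) (lift U) :=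
    fun c => by
      rw [lift_partialDeriv_eq_cwd (hU.isContDiff (by simp)), ← cwd_append]
  have hUl2 : ∀ c : List ι, c.length + 1 ≤ m →
      l2On (closedCube ι) (cwd c (lift (partialDeriv j U))) ≤ √EU := fun c hc => by
    rw [hcwdU]
    exact l2On_cwd_lift_le_sqrt_twordEnergy hU (by simpa using hc)
  have hUsup : ∀ c : List ι, c.length + (σ + 1) ≤ m →
      ∀ y, ‖cwd c (lift (partialDeriv j U)) y‖ ≤ √(Cs * EU) :=
    fun c hc y => by
      rw [hcwdU]
      exact norm_cwd_lift_le_sqrt_of_margin hCs hCs0.le hU (by simp; omega) y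
  -- the expansion
  obtain ⟨r, hr, hne⟩ := splittings_eq_cons w
  have hlen : ∀ p ∈ r, p.1.length + p.2.length = w.length := fun p hp =>
    length_add_length_of_mem_splittings (by rw [hr]; exact List.mem_cons_of_mem _ hp)
  have hrlen : r.length ≤ 2 ^ m := length_le_two_pow_of_splittings_eq_cons hr hwm
  have hlift := lift_tcomm_eq hG hV hUj hr
  -- each term
  have hterm : ∀ p ∈ r, l2On (closedCube ι)
      (fun y => cwd p.1 (fun z => G (lift V z)) y (cwd p.2 (lift (partialDeriv j U)) y)) ≤
        T * √EU := by
    intro p hp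
    have hp1 : 1 ≤ p.1.length :=
      Nat.one_le_iff_ne_zero.2 fun h0 => hne p hp (List.eq_nil_of_length_eq_zero h0)
    have hsum := hlen p hp
    by_cases hcase : p.1.length ≤ m - σ
    · calc l2On (closedCube ι)
            (fun y => cwd p.1 (fun z => G (lift V z)) y (cwd p.2 (lift (partialDeriv j U)) y))
          ≤ C₁ * l2On (closedCube ι) (cwd p.2 (lift (partialDeriv j U))) :=
            l2On_clm_apply_le_of_norm_le hK (h1 p.1 hcase) hC₁0 (continuous_cwd hUj _)
        _ ≤ C₁ * √EU := mul_le_mul_of_nonneg_left (hUl2 p.2 (by omega)) hC₁0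
        _ ≤ T * √EU := mul_le_mul_of_nonneg_right (le_max_left _ _) (Real.sqrt_nonneg _)
    · push Not at hcase
      calc l2On (closedCube ι)
            (fun y => cwd p.1 (fun z => G (lift V z)) y (cwd p.2 (lift (partialDeriv j U)) y))
          ≤ √(Cs * EU) * l2On (closedCube ι) (cwd p.1 (fun z => G (lift V z))) :=
            l2On_clm_apply_le_of_norm_le_right hK (continuous_cwd hGV _) (hUsup p.2 (by omega))
              (Real.sqrt_nonneg _)
        _ ≤ √(Cs * EU) * (C₂ * (1 + √E₀)) :=
            mul_le_mul_of_nonneg_left (h2 p.1 (by omega)) (Real.sqrt_nonneg _)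
        _ = √Cs * (C₂ * (1 + √E₀)) * √EU := by rw [Real.sqrt_mul hCs0.le]; ring
        _ ≤ T * √EU := mul_le_mul_of_nonneg_right (le_max_right _ _) (Real.sqrt_nonneg _)
  -- summation
  have hcont : ∀ p ∈ r, Continuous fun y =>
      cwd p.1 (fun z => G (lift V z)) y (cwd p.2 (lift (partialDeriv j U)) y) := fun p _ =>
    (continuous_cwd hGV _).clm_apply (continuous_cwd hUj _)
  have hl2 : l2On (closedCube ι) (lift (tcomm G V w (partialDeriv j U))) ≤ 2 ^ m * T * √EU := by
    rw [hlift]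
    calc l2On (closedCube ι) (fun y =>
            (r.map fun p => cwd p.1 (fun z => G (lift V z)) y
              (cwd p.2 (lift (partialDeriv j U)) y)).sum)
        ≤ (r.map fun p => l2On (closedCube ι) (fun y =>
            cwd p.1 (fun z => G (lift V z)) y (cwd p.2 (lift (partialDeriv j U)) y))).sum :=
          l2On_list_sum_le hK r hcont
      _ ≤ (r.map fun _ => T * √EU).sum := List.sum_le_sum hterm
      _ = r.length * (T * √EU) := by simp [List.map_const', List.sum_replicate]
      _ ≤ 2 ^ m * (T * √EU) := mul_le_mul_of_nonneg_right (by exact_mod_cast hrlen) (by positivity)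
      _ = 2 ^ m * T * √EU := by ring
  rw [← l2On_closedCube_lift_sq (isSmooth_tcomm hG hV w hUj).continuous]
  calc l2On (closedCube ι) (lift (tcomm G V w (partialDeriv j U))) ^ 2 ≤ (2 ^ m * T * √EU) ^ 2 :=
        pow_le_pow_left₀ (l2On_nonneg _ _) hl2 2
    _ = (2 ^ m * T) ^ 2 * EU := by rw [mul_pow, Real.sq_sqrt hEU0]

/-- **Regularity-step commutator estimate at margin `σ`** (`m ≥ 2σ + 4`): under a word-form sup
embedding at margin `σ` on `𝕋^ι`, for a smooth operator-valued `G` and a bound `E₀` there is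
`C ≥ 0` such that for all smooth `V, U` with `twordEnergy (m-1) V ≤ E₀` and
`twordEnergy (m-1) U ≤ E₀`, all words `|w| ≤ m` and all `j`,

  `∫_𝕋 ‖[∂^w, G(V)] ∂ⱼU‖² ≤ C · (twordEnergy m U + twordEnergy m V + 1)`,

linear in the level-`m` energies with constants from the level-`(m-1)` bounds. The `𝕋³` case
`σ = 2`, `m ≥ 8` is `exists_tcomm_sq_integral_le_step`.
[cite: Majda1984, Ch. 2 §2.1, proof of Thm 2.1, Prop. 2.1 (2.2); Cor. 1 of Thm 2.2] -/
theorem exists_tcomm_sq_integral_le_step_of_wordSup {σ : ℕ} (hS : WordSupEmbedding.{u, v} ι σ)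
    {G : W → (W →L[ℝ] W')} (hG : ContDiff ℝ ∞ G) {m : ℕ} (hm : 2 * σ + 4 ≤ m) (E₀ : ℝ) :
    ∃ C : ℝ, 0 ≤ C ∧ ∀ V U : UnitAddTorus ι → W, IsSmooth V → IsSmooth U →
      twordEnergy (m - 1) V ≤ E₀ → twordEnergy (m - 1) U ≤ E₀ → ∀ w ∈ wordsLE ι m, ∀ j : ι,
        ∫ x, ‖tcomm G V w (partialDeriv j U) x‖ ^ 2 ≤
          C * (twordEnergy m U + twordEnergy m V + 1) := by
  obtain ⟨Cs, hCs0, hCs⟩ := hS W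
  have hK : IsCompact (closedCube ι) := isCompact_closedCube
  set R₁ : ℝ := √(Cs * E₀) with hR₁_def
  set F : EuclideanSpace ℝ ι × W → (W →L[ℝ] W') := fun z => G z.2 with hF_def
  have hF : ContDiff ℝ ∞ F := hG.comp contDiff_snd
  obtain ⟨C₁, hC₁0, hC₁⟩ :=
    exists_sup_bound_cwd_comp (ι := ι) (J := W) (m - (σ + 1)) hF hK R₁
  obtain ⟨C₂, hC₂0, hC₂⟩ := exists_tame_bound_cwd_comp (ι := ι) (J := W) m hF hK R₁
  set T : ℝ := max C₁ (R₁ * C₂) with hT_def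
  have hT0 : 0 ≤ T := hC₁0.trans (le_max_left _ _)
  refine ⟨3 * (2 ^ m * T) ^ 2, by positivity, fun V U hV hU hVE hUE w hw j => ?_⟩
  have hwm : w.length ≤ m := mem_wordsLE.1 hw
  -- control of `V` from level `m - 1`, and its level-`m` size
  have hVsup : ∀ c : List ι, c.length ≤ m - (σ + 1) → ∀ y ∈ closedCube ι,
      ‖cwd c (lift V) y‖ ≤ R₁ :=
    fun c hc y _ => (norm_cwd_lift_le_sqrt_of_margin hCs hCs0.le hV (by omega) y).trans
      (Real.sqrt_le_sqrt (mul_le_mul_of_nonneg_left hVE hCs0.le))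
  have hVsup' : ∀ c : List ι, c.length ≤ m / 2 + 1 → ∀ y ∈ closedCube ι, ‖cwd c (lift V) y‖ ≤ R₁ :=
    fun c hc => hVsup c (by omega)
  set EV : ℝ := twordEnergy m V with hEV_def
  have hEV0 : 0 ≤ EV := twordEnergy_nonneg m V
  have hVl2 : ∀ c : List ι, c.length ≤ m → l2On (closedCube ι) (cwd c (lift V)) ≤ √EV :=
    fun c hc => l2On_cwd_lift_le_sqrt_twordEnergy hV hc
  have hGV : ContDiff ℝ ∞ fun y => G (lift V y) := hG.comp hV
  have h1 : ∀ v : List ι, v.length ≤ m - (σ + 1) → ∀ y ∈ closedCube ι,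
      ‖cwd v (fun z => G (lift V z)) y‖ ≤ C₁ := hC₁ (lift V) hV hVsup
  have h2 : ∀ v : List ι, v.length ≤ m →
      l2On (closedCube ι) (cwd v (fun z => G (lift V z))) ≤ C₂ * (1 + √EV) :=
    hC₂ (lift V) hV hVsup' (√EV) (Real.sqrt_nonneg _) hVl2
  -- control of `U`: level `m` in `L²`, level `m - 1` in sup
  set EU : ℝ := twordEnergy m U with hEU_def
  have hEU0 : 0 ≤ EU := twordEnergy_nonneg m U
  have hUj : IsSmooth (partialDeriv j U) := hU.partialDeriv j
  have hcwdU : ∀ c : List ι, cwd c (lift (partialDeriv j U)) = cwd (c ++ [j]) (lift U) :=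
    fun c => by
      rw [lift_partialDeriv_eq_cwd (hU.isContDiff (by simp)), ← cwd_append]
  have hUl2 : ∀ c : List ι, c.length + 1 ≤ m →
      l2On (closedCube ι) (cwd c (lift (partialDeriv j U))) ≤ √EU := fun c hc => by
    rw [hcwdU]
    exact l2On_cwd_lift_le_sqrt_twordEnergy hU (by simpa using hc)
  have hUsup : ∀ c : List ι, c.length + (σ + 1) ≤ m - 1 →
      ∀ y, ‖cwd c (lift (partialDeriv j U)) y‖ ≤ R₁ :=
    fun c hc y => by
      rw [hcwdU]
      exact (norm_cwd_lift_le_sqrt_of_margin hCs hCs0.le hU (by simp; omega) y).trans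
        (Real.sqrt_le_sqrt (mul_le_mul_of_nonneg_left hUE hCs0.le))
  have hR₁0 : 0 ≤ R₁ := Real.sqrt_nonneg _
  -- the expansion
  obtain ⟨r, hr, hne⟩ := splittings_eq_cons w
  have hlen : ∀ p ∈ r, p.1.length + p.2.length = w.length := fun p hp =>
    length_add_length_of_mem_splittings (by rw [hr]; exact List.mem_cons_of_mem _ hp)
  have hrlen : r.length ≤ 2 ^ m := length_le_two_pow_of_splittings_eq_cons hr hwm
  have hlift := lift_tcomm_eq hG hV hUj hr
  set S : ℝ := √EU + √EV + 1 with hS_def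
  have hS0 : 0 ≤ S := by positivity
  -- each term
  have hterm : ∀ p ∈ r, l2On (closedCube ι)
      (fun y => cwd p.1 (fun z => G (lift V z)) y (cwd p.2 (lift (partialDeriv j U)) y)) ≤
        T * S := by
    intro p hp
    have hp1 : 1 ≤ p.1.length :=
      Nat.one_le_iff_ne_zero.2 fun h0 => hne p hp (List.eq_nil_of_length_eq_zero h0)
    have hsum := hlen p hp
    by_cases hcase : p.1.length ≤ m - (σ + 1)
    · calc l2On (closedCube ι)
            (fun y => cwd p.1 (fun z => G (lift V z)) y (cwd p.2 (lift (partialDeriv j U)) y))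
          ≤ C₁ * l2On (closedCube ι) (cwd p.2 (lift (partialDeriv j U))) :=
            l2On_clm_apply_le_of_norm_le hK (h1 p.1 hcase) hC₁0 (continuous_cwd hUj _)
        _ ≤ C₁ * √EU := mul_le_mul_of_nonneg_left (hUl2 p.2 (by omega)) hC₁0
        _ ≤ T * S := by
            refine mul_le_mul (le_max_left _ _) ?_ (Real.sqrt_nonneg _) hT0
            rw [hS_def]
            linarith [Real.sqrt_nonneg EV]
    · push Not at hcase
      calc l2On (closedCube ι)
            (fun y => cwd p.1 (fun z => G (lift V z)) y (cwd p.2 (lift (partialDeriv j U)) y))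
          ≤ R₁ * l2On (closedCube ι) (cwd p.1 (fun z => G (lift V z))) :=
            l2On_clm_apply_le_of_norm_le_right hK (continuous_cwd hGV _) (hUsup p.2 (by omega))
              hR₁0
        _ ≤ R₁ * (C₂ * (1 + √EV)) := mul_le_mul_of_nonneg_left (h2 p.1 (by omega)) hR₁0
        _ = R₁ * C₂ * (1 + √EV) := by ring
        _ ≤ T * S := by
            refine mul_le_mul (le_max_right _ _) ?_ (by positivity) hT0
            rw [hS_def]
            linarith [Real.sqrt_nonneg EU]
  -- summation
  have hcont : ∀ p ∈ r, Continuous fun y =>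
      cwd p.1 (fun z => G (lift V z)) y (cwd p.2 (lift (partialDeriv j U)) y) := fun p _ =>
    (continuous_cwd hGV _).clm_apply (continuous_cwd hUj _)
  have hl2 : l2On (closedCube ι) (lift (tcomm G V w (partialDeriv j U))) ≤ 2 ^ m * T * S := by
    rw [hlift]
    calc l2On (closedCube ι) (fun y =>
            (r.map fun p => cwd p.1 (fun z => G (lift V z)) y
              (cwd p.2 (lift (partialDeriv j U)) y)).sum)
        ≤ (r.map fun p => l2On (closedCube ι) (fun y =>
            cwd p.1 (fun z => G (lift V z)) y (cwd p.2 (lift (partialDeriv j U)) y))).sum :=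
          l2On_list_sum_le hK r hcont
      _ ≤ (r.map fun _ => T * S).sum := List.sum_le_sum hterm
      _ = r.length * (T * S) := by simp [List.map_const', List.sum_replicate]
      _ ≤ 2 ^ m * (T * S) := mul_le_mul_of_nonneg_right (by exact_mod_cast hrlen) (by positivity)
      _ = 2 ^ m * T * S := by ring
  rw [← l2On_closedCube_lift_sq (isSmooth_tcomm hG hV w hUj).continuous]
  have hS2 : S ^ 2 ≤ 3 * (EU + EV + 1) := by
    rw [hS_def]
    nlinarith [Real.sq_sqrt hEU0, Real.sq_sqrt hEV0, Real.sqrt_nonneg EU, Real.sqrt_nonneg EV,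
      sq_nonneg (√EU - √EV), sq_nonneg (√EU - 1), sq_nonneg (√EV - 1)]
  calc l2On (closedCube ι) (lift (tcomm G V w (partialDeriv j U))) ^ 2 ≤ (2 ^ m * T * S) ^ 2 :=
        pow_le_pow_left₀ (l2On_nonneg _ _) hl2 2
    _ = (2 ^ m * T) ^ 2 * S ^ 2 := by ring
    _ ≤ (2 ^ m * T) ^ 2 * (3 * (EU + EV + 1)) := mul_le_mul_of_nonneg_left hS2 (by positivity)
    _ = 3 * (2 ^ m * T) ^ 2 * (EU + EV + 1) := by ring

end Commutator

/-! ## The `𝕋³` theorems recovered (margin `2`) -/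

section Three

variable [FiniteDimensional ℝ W]

/-- On `𝕋^ι` with `#ι = 3` the tree's real-variable `H² ⊂ L^∞` gives the word-form sup embedding
at margin `2` (so the three `𝕋³` theorems of `TorusMoserCommutator` are the `σ = 2` instances of
the generic ones). [cite: Adams1975, Thm. 5.4 Part I Case C (mp > n)] -/
theorem wordSupEmbedding_two_of_card_eq_three (hd : Fintype.card ι = 3) :
    WordSupEmbedding.{u, v} ι 2 :=
  fun F' _ _ _ => exists_norm_sq_le_twordEnergy_two (F' := F') hd

end Three

end Literature.Analysis.PDE

end
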